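import Summits.ValiantsHypothesis.ValiantsHypothesis.Theorems.ExactCoverIndicator
import Literature.Computability.AlgebraicComplexity.ValiantCriterionCounting
import Literature.Computability.AlgebraicComplexity.ValiantConjectureEquivProofs
import HarnessLib

/-!
# Block Laplace lift: syntactically multilinear circuits for the permanent from `VP = VNP`
(decomposition workshop `decomp-valiant`, lens 6 «restricted-models lifting axis», gen 3; support
kernel for the split of `DecompCycle1.TamePer` into the crux `PerNotSmVP`
(stmt-ValiantsHypothesis-23661) and the lifting residual `TameOrSmLift`
(stmt-ValiantsHypothesis-23662))

* `isVPFamily_indPoly`, `isVNPFamily_xcPoly`: `(XC_(c,m))_m ∈ VNP` for each fixed `c` — the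
  indicator family has `m·C(mc,c)` variables, degree and size polynomial in `m`, and `XC_(c,m)` is
  the generating polynomial of its Boolean part (`ExactCoverIndicator.genPolyV_indPoly`), so the
  tree's Valiant criterion `isVNPFamily_genPoly` (Bürgisser 2000, Prop. 2.20) applies.
* `exists_smCircuit_perPoly_of_VP_eq_VNP` (**the lifting rung `B_c`**): if `VP k = VNP k` then for
  every `c` there is `a` with: every `per_(mc)` has a fan-in-two syntactically multilinear circuit
  of size `≤ a (m+1)^a 4^m` (`= 2^((2/c) n) poly(n)` at `n = mc`) — from the mechanism theorem
  `BlockLaplaceCircuit.exists_smCircuit_perPoly` and `XC_(c,•) ∈ VNP = VP`.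

Consequence recorded in the workshop node `SmThreshold` (lens 6 gen 3): a `2^((2/c) n)·ω(poly)`
lower bound for syntactically multilinear circuits computing `per_n` along `n ≡ 0 (mod c)`, for any
one fixed `c`, implies `VP ≠ VNP` over `ℂ`; for `c ≤ 2` that hypothesis is refuted by Ryser's
formula, for `c ≥ 3` it is open. HONEST FRAMING: circuit bookkeeping of published constructions (block Laplace expansion,
Limaye–Srinivasan–Tavenas Lemma 12, Valiant's criterion); nothing here bears on the truth of
`VP ≠ VNP`.

## References

* [Minc1978] H. Minc, *Permanents*, Addison–Wesley 1978, Ch. 2, Thm. 1.2 (Laplace expansion).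
* [LimayeSrinivasanTavenas2025] N. Limaye, S. Srinivasan, S. Tavenas, J. ACM 72 (2025), Art. 26,
  Lemma 12.
* [Burgisser2000] P. Bürgisser, *Completeness and Reduction in Algebraic Complexity Theory*,
  Springer 2000, Def. 2.1, Prop. 2.20, Rem. 2.2.
* [RazYehudayoff2008] R. Raz, A. Yehudayoff, Comput. Complexity 17 (2008), §2.
-/

noncomputable section

namespace Summit.ValiantsHypothesis.ValiantsHypothesis.Theorems.BlockLaplaceLift

open Finset Matrix Summit.ValiantsHypothesis.ValiantsHypothesis.Theorems.BlockLaplaceExpansion Summit.ValiantsHypothesis.ValiantsHypothesis.Theorems.BlockLaplaceCircuit Summit.ValiantsHypothesis.ValiantsHypothesis.Theorems.ExactCoverIndicator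

/-! ## Part VI — `XC_{c,•} ∈ VNP`, and the lifting rung `B_c` -/

section VNPMembership

open MvPolynomial Literature.Computability.AlgebraicComplexity

variable (R : Type*) [CommRing R]

/-- There are `C(n, c)` column sets. [folklore] -/
theorem card_PowC (n c : ℕ) : Fintype.card (PowC n c) = n.choose c := by
  convert Fintype.card_finset_len (α := Fin n) c using 1
  rw [Fintype.card_fin]

/-- The number of variables `m · C(mc, c)` of `XC_{c,m}`. [folklore] -/
theorem card_vars_eq (m c : ℕ) :
    Fintype.card (Fin m × PowC (m * c) c) = m * (m * c).choose c := by
  rw [Fintype.card_prod, Fintype.card_fin, card_PowC]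

/-- `m · C(mc, c) ≤ m (mc)^c` is p-bounded in `m` for fixed `c`. [cite: Burgisser2000, Def. 2.1] -/
theorem isPBounded_card_vars (c : ℕ) :
    IsPBounded fun m => Fintype.card (Fin m × PowC (m * c) c) := by
  refine (IsPBounded.mul_holds IsPBounded.id
    (IsPBounded.pow_holds (IsPBounded.mul_holds IsPBounded.id (IsPBounded.const c)) c)).mono
    fun m => ?_
  rw [card_vars_eq]
  exact Nat.mul_le_mul_left _ (Nat.choose_le_pow _ _)

/-- Size of the indicator polynomial: `O((m + mc) · N²)`, `N` the number of variables. [cite: Burgisser2000, Def. 2.1] -/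
theorem complexity_indPoly_le (m c : ℕ) :
    complexity (indPoly R m c) ≤ (m + m * c) *
      (3 * Fintype.card (Fin m × PowC (m * c) c) ^ 2 +
        5 * Fintype.card (Fin m × PowC (m * c) c) + 2) + 1 := by
  set N := Fintype.card (Fin m × PowC (m * c) c)
  have hb : ∀ b, complexity (ex1Poly R (blockVars m c b)) ≤ 3 * N ^ 2 + 5 * N + 1 := fun b => by
    have h := complexity_ex1Poly_le (R := R) (blockVars m c b)
    have : (blockVars m c b).card ≤ N := Finset.card_le_univ _
    nlinarith
  have hj : ∀ j, complexity (am1Poly R (colVars m c j)) ≤ 3 * N ^ 2 + 5 * N + 1 := fun j => by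
    have h := complexity_am1Poly_le (R := R) (colVars m c j)
    have : (colVars m c j).card ≤ N := Finset.card_le_univ _
    nlinarith
  have h1 := (complexity_finset_prod_le Finset.univ fun b => ex1Poly R (blockVars m c b)).trans
    (Nat.add_le_add_right (Finset.sum_le_card_nsmul _ _ _ fun b _ => hb b) _)
  have h2 := (complexity_finset_prod_le Finset.univ fun j => am1Poly R (colVars m c j)).trans
    (Nat.add_le_add_right (Finset.sum_le_card_nsmul _ _ _ fun j _ => hj j) _)
  simp only [Finset.card_univ, Fintype.card_fin, smul_eq_mul] at h1 h2
  unfold indPoly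
  refine (complexity_mul_le_holds _ _).trans ?_
  linarith [h1, h2]

/-- Degree of the indicator polynomial: `≤ (m + mc)(N + 1)`. [folklore] -/
theorem totalDegree_indPoly_le (m c : ℕ) :
    (indPoly R m c).totalDegree ≤ (m + m * c) * (Fintype.card (Fin m × PowC (m * c) c) + 1) := by
  set N := Fintype.card (Fin m × PowC (m * c) c)
  have h1 := (totalDegree_finsetProd Finset.univ fun b => ex1Poly R (blockVars m c b)).trans
    (Finset.sum_le_card_nsmul _ _ (N + 1) fun b _ =>
      (totalDegree_ex1Poly_le (R := R) _).trans (Nat.add_le_add_right (Finset.card_le_univ _) 1))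
  have h2 := (totalDegree_finsetProd Finset.univ fun j => am1Poly R (colVars m c j)).trans
    (Finset.sum_le_card_nsmul _ _ (N + 1) fun j _ =>
      (totalDegree_am1Poly_le (R := R) _).trans (Nat.add_le_add_right (Finset.card_le_univ _) 1))
  simp only [Finset.card_univ, Fintype.card_fin, smul_eq_mul] at h1 h2
  refine (totalDegree_mul _ _).trans ?_
  rw [add_mul]
  exact Nat.add_le_add h1 h2

/-- The indicator family is in `VP` (polynomially many variables, degree and size).
[cite: Burgisser2000, Prop. 2.20] -/
theorem isVPFamily_indPoly (c : ℕ) :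
    IsVPFamily (σ := fun m => Fin m × PowC (m * c) c) (fun m => indPoly R m c) := by
  have hN := isPBounded_card_vars c
  have hmc : IsPBounded fun m => m + m * c :=
    IsPBounded.add_holds IsPBounded.id (IsPBounded.mul_holds IsPBounded.id (IsPBounded.const c))
  refine ⟨⟨hN, ?_⟩, ?_⟩
  · exact (IsPBounded.mul_holds hmc (IsPBounded.add_holds hN (IsPBounded.const 1))).mono
      fun m => totalDegree_indPoly_le R m c
  · exact (IsPBounded.add_holds (IsPBounded.mul_holds hmc (IsPBounded.add_holds
      (IsPBounded.add_holds (IsPBounded.mul_holds (IsPBounded.const 3) (IsPBounded.pow_holds hN 2))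
        (IsPBounded.mul_holds (IsPBounded.const 5) hN)) (IsPBounded.const 2)))
      (IsPBounded.const 1)).mono fun m => complexity_indPoly_le R m c

/-- **`(XC_{c,m})_m ∈ VNP`** for every fixed `c`: `XC_{c,m}` is the generating polynomial of the
Boolean part of the `VP` family `indPoly`, so Valiant's criterion (the tree's
`isVNPFamily_genPoly`, Bürgisser 2000, Prop. 2.20) applies. [cite: Burgisser2000, Prop. 2.20] -/
theorem isVNPFamily_xcPoly (c : ℕ) :
    IsVNPFamily (σ := fun m => Fin m × PowC (m * c) c) (fun m => xcPoly R m c) := by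
  classical
  let ε : ∀ m, Fin m × PowC (m * c) c ≃ Fin (Fintype.card (Fin m × PowC (m * c) c)) :=
    fun m => Fintype.equivFin _
  have hF : IsVPFamily (σ := fun m => Fin (Fintype.card (Fin m × PowC (m * c) c)))
      (fun m => renameEquiv R (ε m) (indPoly R m c)) :=
    (isVPFamily_renameEquiv_iff ε _).2 (isVPFamily_indPoly R c)
  have hG := isVNPFamily_genPoly (IsVPFamily.isVNPFamily_holds' hF)
  have heq : (fun m => ValiantCriterion.genPoly (renameEquiv R (ε m) (indPoly R m c))) =
      fun m => renameEquiv R (ε m) (xcPoly R m c) := by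
    funext m
    rw [renameEquiv_apply, renameEquiv_apply, genPoly_rename_equiv, genPolyV_indPoly]
  rw [heq] at hG
  exact (isVNPFamily_renameEquiv_iff ε _).1 hG

/-- **The lifting rung `B_c`** (unconditional theorem; the content of the residual disjunct
"`VP = VNP` lifts to syntactically multilinear circuits" at exponential-in-`m` loss): if
`VP = VNP` over a commutative ring `k`, then for every block size `c` there is `a` such that
`per_{mc}` has fan-in-two syntactically multilinear circuits of size `≤ a (m+1)^a · 4^m` for all `m`
— i.e. `2^{(2/c) n} · poly(n)` at `n = mc`. Block Laplace expansion into `m` blocks, LST Lemma 12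
(loss `4^{#blocks}`) and `XC_{c,•} ∈ VNP = VP`. [cite: LimayeSrinivasanTavenas2025, Lemma 12] -/
theorem exists_smCircuit_perPoly_of_VP_eq_VNP (c : ℕ) (h : VP R = VNP R) :
    ∃ a : ℕ, ∀ m : ℕ, ∃ P : ArithCircuit R (Fin (m * c) × Fin (m * c)), P.IsFanInTwo ∧
      IsSyntacticallyMultilinear P ∧ P.Computes (perPoly (Fin (m * c)) R) ∧
      P.size ≤ a * (m + 1) ^ a * 4 ^ m := by
  classical
  have hvnp : PolyFamily.ofFintype (fun m => xcPoly R m c) ∈ VNP R :=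
    (mem_VNP_ofFintype_iff_holds _).2 (isVNPFamily_xcPoly R c)
  rw [← h] at hvnp
  obtain ⟨a', ha'⟩ := ((mem_VP_ofFintype_iff_holds _).1 hvnp).2
  set K := 2 * 4 ^ c * complexity (perPoly (Fin c) R) with hK
  refine ⟨K * c ^ c + 2 * a' + c + 3, fun m => ?_⟩
  obtain ⟨P, hP2, hPsm, hPf, hPs⟩ := exists_smCircuit_perPoly R m c
  refine ⟨P, hP2, hPsm, hPf, hPs.trans ?_⟩
  set a := K * c ^ c + 2 * a' + c + 3 with ha
  have hc : Fintype.card (PowC (m * c) c) ≤ m ^ c * c ^ c := by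
    rw [card_PowC, ← mul_pow]
    exact Nat.choose_le_pow _ _
  have h4 : 1 ≤ 4 ^ m := Nat.one_le_pow _ _ (by norm_num)
  have hm1 : m ^ (c + 1) ≤ (m + 1) ^ a :=
    (Nat.pow_le_pow_left (Nat.le_succ m) _).trans (Nat.pow_le_pow_right (Nat.succ_pos m) (by omega))
  have hm2 : m ^ a' ≤ (m + 1) ^ a :=
    (Nat.pow_le_pow_left (Nat.le_succ m) _).trans (Nat.pow_le_pow_right (Nat.succ_pos m) (by omega))
  have hm3 : 1 ≤ (m + 1) ^ a := Nat.one_le_pow _ _ (Nat.succ_pos m)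
  have e1 : m * Fintype.card (PowC (m * c) c) ≤ c ^ c * (m + 1) ^ a :=
    calc m * Fintype.card (PowC (m * c) c) ≤ m * (m ^ c * c ^ c) := Nat.mul_le_mul_left _ hc
      _ = c ^ c * m ^ (c + 1) := by ring
      _ ≤ c ^ c * (m + 1) ^ a := Nat.mul_le_mul_left _ hm1
  have e2 : complexity (xcPoly R m c) ≤ (1 + a') * (m + 1) ^ a :=
    calc complexity (xcPoly R m c) ≤ m ^ a' + a' := ha' m
      _ ≤ (m + 1) ^ a + a' * (m + 1) ^ a := Nat.add_le_add hm2 (Nat.le_mul_of_pos_right _ hm3)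
      _ = (1 + a') * (m + 1) ^ a := by ring
  calc K * (m * Fintype.card (PowC (m * c) c)) + 2 * 4 ^ m * complexity (xcPoly R m c)
      ≤ K * (c ^ c * (m + 1) ^ a) + 2 * 4 ^ m * ((1 + a') * (m + 1) ^ a) :=
        Nat.add_le_add (Nat.mul_le_mul_left _ e1) (Nat.mul_le_mul_left _ e2)
    _ ≤ K * c ^ c * (m + 1) ^ a * 4 ^ m + (2 + 2 * a') * (m + 1) ^ a * 4 ^ m := by
        refine Nat.add_le_add ?_ (le_of_eq (by ring))
        calc K * (c ^ c * (m + 1) ^ a) = K * c ^ c * (m + 1) ^ a * 1 := by ring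
          _ ≤ K * c ^ c * (m + 1) ^ a * 4 ^ m := Nat.mul_le_mul_left _ h4
    _ = (K * c ^ c + 2 + 2 * a') * ((m + 1) ^ a * 4 ^ m) := by ring
    _ ≤ a * ((m + 1) ^ a * 4 ^ m) := Nat.mul_le_mul_right _ (by omega)
    _ = a * (m + 1) ^ a * 4 ^ m := by ring

end VNPMembership

end Summit.ValiantsHypothesis.ValiantsHypothesis.Theorems.BlockLaplaceLift
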